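import Summits.BirchSwinnertonDyer.BirchSwinnertonDyer.Theorems.ByReductionTypeAtTwoAdditiveDescentKDoor
import Summits.BirchSwinnertonDyer.Rank1Residual.Additive.CyclotomicThreeDescentData
import Summits.BirchSwinnertonDyer.Rank1Residual.Additive.QuadraticFieldCriterionThree
import Literature.NumberTheory.EllipticCurves.FrobeniusTraceBaseChange
import Literature.NumberTheory.EllipticCurves.IsogenyFrobeniusTraceProofs
import Literature.NumberTheory.EllipticCurves.QuadraticTwistRamifiedLocalPolynomialProofs
import Literature.NumberTheory.EllipticCurves.BSDConductorProofs
import Literature.NumberTheory.EllipticCurves.BSDQuadraticDescentTorsionOddPartProofs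
import Literature.NumberTheory.EllipticCurves.IwasawaSelmerSupersingularLocalProofs
import Literature.NumberTheory.EllipticCurves.LFunctionPrimeCoeff
import Literature.NumberTheory.EllipticCurves.CyclotomicZpExtension
import Literature.NumberTheory.EllipticCurves.ZpExtensionDihedralProofs
import Literature.NumberTheory.EllipticCurves.InertiaAboveEllCyclotomicProofs
import Literature.NumberTheory.GaloisRepresentations.AbsGaloisOuterConj
import Literature.NumberTheory.QuadraticFields.SquareRootGenerator
import HarnessLib

/-!
# Route `ByReductionTypeAtTwo` (rung K4), crux `AdditiveRankZeroAtTwo` (item stmt-BirchSwinnertonDyer-19098), LINE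
# `add-twist-overK`: the four LOCAL elementary displays of the `K* = ℚ(i)` descent door DISCHARGED in the kernel —
# `hTam`, `hgoodK`, `hredK`, `hdatK` (seat `bsd-2adic-addL2`, GEN 7; MEMO-5 ADDENDUM-1 §B2, R84)

HONEST FRAMING (cell `bsd-2adic`, run/shared/lean/pub/bsd-2adic/, HUMAN RULINGS D-0036/D-0054/D-0074): THEOREMS ONLY
(no definition, no named fact introduced, nothing asserted, closes nothing). PARTITION: X5@2 ADDITIVE (B1·O1), quadratic
sub-class with `d* = −1`, semistable twist GOOD ORDINARY at `2`, `Δ < 0` (the two CANDIDATE classes 274032m, 265200dr)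
× p = 2 — types-the-object-of (four of the five elementary displayed identities of the GEN-6 door
`AddDescentK.bsdp_two_of_pinchK_greenbergK`, p451563, become kernel theorems); closes none.

WHAT IS PROVED (for `Wd/ℚ` globally minimal; `K` a number field, quadratic where stated):
* `padicValRat_modifiedTamagawaProduct_baseChange_two` (**`hTam`**): `ord₂ C(Wd ⊗ K, ω) = ord₂ ∏_w c_w(Wd_K)` when
  `Wd` has good reduction at `2` — the tree's `padicValRat_modifiedTamagawaProduct_baseChange` (Dokchitser–Dokchitser's
  `C(E/K)`: `|ω/ω°_w|_w = 1` above the good prime `2`, an odd norm power elsewhere).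
* `hasGoodReductionAt_baseChange_of_isOrdinaryAt_two` (**`hgoodK`**): `Wd ⊗ K` has good reduction at every `v ∣ 2`
  with ODD `a_v` when `Wd` is good ordinary at `2` — base change of good reduction (Silverman VII.5.4(a)) and
  `a_v = D_f(a₂; 2)` (Dickson/Newton, tree `frobeniusTraceAt_baseChange_eq_eval_dickson`), `D_f(a; q) ≡ a·D_{f−1}`
  mod `q`: odd for `a` odd, `q = 2` (`odd_eval_dickson_succ`).
* `finprod_natCard_primaryComponent_reductionAt_two` (**`hredK`**): for `K` quadratic with `2 ∣ d_K` (ramified: ONE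
  place `w ∣ 2`, `f(w|2) = 1`, `N(w) = 2` — tree `exists_unique_place_of_dvd_discr`, `absNorm_eq_of_quadratic_of_dvd_discr`)
  the `2`-primary parts of `Ẽ_w(k_w)` and of the reduction of the minimal model mod `2` have the same order:
  `#Ẽ_w(k_w) = N(w) + 1 − a_w = 2 + 1 − a₂ = #W̃(𝔽₂)`.
* `exists_isCyclotomic_isCycVariableOver_of_discr_eq_neg_four` (**`hdatK`**): a quadratic field of discriminant
  `−4` carries a cyclotomic `ℤ₂`-extension datum `κ` with topological generator `γ`, `κ(γ) = 1`, `χ_cyc(γ) = 5`: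
  `σ₀ ∈ Γ_ℚ` with `χ₂(σ₀) = 5` (surjectivity of `χ₂` on `Γ_ℚ`) fixes `i` (`5 ≡ 1 mod 4`), hence `ℚ(i) = K`, so
  `σ₀ = res(γ₀)`; `κ = ℓ ∘ χ₂^K` with `ℓ = log/log 5` (tree `CyclotomicZp.ellHom`), onto by saturation.

References: [SilvermanAEC2009] V.2.3.1, VII.5.1, VII.5.4, C.16; [DokchitserDokchitserAnnals2010] §1;
[Marcus1977] Ch. 3 Thm. 25 (ramified primes of a quadratic field); [Washington1997] §13.1.
-/

set_option autoImplicit false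
-- the Theorems namespace of this sub repeats the summit name by design (D-0017 nested layout)
set_option linter.dupNamespace false

noncomputable section

open scoped Classical MatrixGroups ModularForm NumberField NumberTheorySymbols

open CongruenceSubgroup WeierstrassCurve IsDedekindDomain Literature.NumberTheory.EllipticCurves
  Literature.NumberTheory.EllipticCurves.ModularForms
  Literature.NumberTheory.EllipticCurves.Rank1Residual
  Literature.NumberTheory.EllipticCurves.Rank1Residual.Typed
  Literature.NumberTheory.EllipticCurves.Greenberg1999
  Literature.NumberTheory.QuadraticFields
  Summit.BirchSwinnertonDyer.Rank1Residual.AdditivePotMult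
  Summit.BirchSwinnertonDyer.Rank1Residual.X5.AddTwoL2
  Summit.BirchSwinnertonDyer.Rank1Residual.X5.AddTwoL2Cyc
  Summit.BirchSwinnertonDyer.Rank1Residual.X5.AddTwoL2Pinch

namespace Summit.BirchSwinnertonDyer.BirchSwinnertonDyer.Theorems

namespace AddDescentK

/-! ## §A `hTam` -/

/-- `hTam` discharged: for `Wd/ℚ` globally minimal with good reduction at `2` and any number field `K`,
`ord₂ C(Wd ⊗ K) = ord₂ ∏_w c_w(Wd_K)` (tree: `padicValRat_modifiedTamagawaProduct_baseChange`). -/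
theorem padicValRat_modifiedTamagawaProduct_baseChange_two (Wd : WeierstrassCurve ℚ) [Wd.IsElliptic]
    [Wd.IsGloballyMinimal] (K : Type) [Field K] [NumberField K] (hgood : Wd.HasGoodReductionAtPrime 2) :
    padicValRat 2 (Wd.baseChange K).modifiedTamagawaProduct =
      padicValNat 2 (Wd.baseChange K).tamagawaProduct :=
  Summit.BirchSwinnertonDyer.Rank1Residual.Additive.padicValRat_modifiedTamagawaProduct_baseChange Wd 2
    (Wd.not_dvd_minimalDiscriminantInt_of_hasGoodReductionAtPrime' 2 hgood)

/-! ## §B `hgoodK` -/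

/-- Parity of Dickson polynomials: for `a` odd and `q` even, `D_{n+1}(a; q)` is odd for every `n`
(`D₁ = X`, `D_{n+2} = X·D_{n+1} − q·D_n`). -/
theorem odd_eval_dickson_succ {a q : ℤ} (ha : Odd a) (hq : Even q) (n : ℕ) :
    Odd ((Polynomial.dickson 1 q (n + 1)).eval a) := by
  induction n with
  | zero => simpa [Polynomial.dickson_one] using ha
  | succ n ih =>
    rw [show n + 1 + 1 = n + 2 from rfl, Polynomial.dickson_add_two, Polynomial.eval_sub,
      Polynomial.eval_mul, Polynomial.eval_X, Polynomial.eval_mul, Polynomial.eval_C]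
    exact Int.odd_sub.mpr (by
      constructor
      · intro _; exact (hq.mul_right _)
      · intro _; exact ha.mul ih)

/-- The place of `ℚ` above `2`. -/
theorem primesEquiv_placeTwo :
    (Rat.HeightOneSpectrum.primesEquiv
      ((Rat.HeightOneSpectrum.primesEquiv (R := 𝓞 ℚ)).symm ⟨2, Nat.prime_two⟩) : ℕ) = 2 := by
  rw [Equiv.apply_symm_apply]

/-- A place `v` of a number field `K` containing `2` lies over the place of `ℚ` above `2`. -/
theorem under_eq_placeTwo_of_two_mem (K : Type) [Field K] [NumberField K] (v : HeightOneSpectrum (𝓞 K))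
    (hv : (2 : 𝓞 K) ∈ v.asIdeal) :
    v.asIdeal.under (𝓞 ℚ) =
      ((Rat.HeightOneSpectrum.primesEquiv (R := 𝓞 ℚ)).symm ⟨2, Nat.prime_two⟩).asIdeal := by
  have hmem : ((2 : ℕ) : 𝓞 ℚ) ∈ v.asIdeal.under (𝓞 ℚ) := by
    rw [Ideal.under_def, Ideal.mem_comap, map_natCast]
    exact_mod_cast hv
  haveI : (v.asIdeal.under (𝓞 ℚ)).IsPrime := Ideal.IsPrime.under (𝓞 ℚ) v.asIdeal
  have hne : v.asIdeal.under (𝓞 ℚ) ≠ ⊥ := by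
    intro h0
    rw [h0] at hmem
    exact two_ne_zero (by exact_mod_cast (Ideal.mem_bot.mp hmem))
  set v' : HeightOneSpectrum (𝓞 ℚ) := ⟨v.asIdeal.under (𝓞 ℚ), inferInstance, hne⟩ with hv'
  have hv'2 : v' = (Rat.HeightOneSpectrum.primesEquiv (R := 𝓞 ℚ)).symm ⟨2, Nat.prime_two⟩ :=
    (natCast_mem_asIdeal_iff_eq_primesEquiv_symm v' Nat.prime_two).mp hmem
  exact congrArg HeightOneSpectrum.asIdeal hv'2

/-- `2` lies in the place of `ℚ` above `2`. -/
theorem two_mem_placeTwo :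
    ((2 : ℕ) : 𝓞 ℚ) ∈ ((Rat.HeightOneSpectrum.primesEquiv (R := 𝓞 ℚ)).symm ⟨2, Nat.prime_two⟩).asIdeal :=
  (natCast_mem_asIdeal_iff_eq_primesEquiv_symm _ Nat.prime_two).mpr rfl

/-- Good reduction of a globally minimal `Wd/ℚ` at the place above `2` from `HasGoodReductionAtPrime 2`. -/
theorem hasGoodReductionAt_placeTwo (Wd : WeierstrassCurve ℚ) [Wd.IsElliptic] [Wd.IsGloballyMinimal]
    (hgood : Wd.HasGoodReductionAtPrime 2) :
    Wd.HasGoodReductionAt ((Rat.HeightOneSpectrum.primesEquiv (R := 𝓞 ℚ)).symm ⟨2, Nat.prime_two⟩) := by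
  have key : ∀ (p : ℕ) (hp : p.Prime), p = 2 → (haveI := Fact.mk hp; Wd.HasGoodReductionAtPrime p) := by
    rintro p hp rfl; exact hgood
  exact (hasGoodReductionAtPrime_iff_hasGoodReductionAt_ringOfIntegers _ Wd).mp
    (key _ (Rat.HeightOneSpectrum.primesEquiv _).2 primesEquiv_placeTwo)

/-- `hgoodK` discharged: for `Wd/ℚ` globally minimal, good ORDINARY at `2`, and any number field `K`,
the base change `Wd ⊗ K` has good reduction at every place `v ∣ 2` with ODD trace of Frobenius
(`a_v = D_f(a₂; 2) ≡ a₂^f (mod 2)`). -/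
theorem hasGoodReductionAt_baseChange_of_isOrdinaryAt_two (Wd : WeierstrassCurve ℚ) [Wd.IsElliptic]
    [Wd.IsGloballyMinimal] (K : Type) [Field K] [NumberField K] (hord : IsOrdinaryAt Wd 2)
    (v : HeightOneSpectrum (𝓞 K)) (hv : (2 : 𝓞 K) ∈ v.asIdeal) :
    (Wd.baseChange K).HasGoodReductionAt v ∧ ¬ (2 : ℤ) ∣ (Wd.baseChange K).frobeniusTraceAt v := by
  set v₂ : HeightOneSpectrum (𝓞 ℚ) := (Rat.HeightOneSpectrum.primesEquiv (R := 𝓞 ℚ)).symm ⟨2, Nat.prime_two⟩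
    with hv₂
  have hp2 : (Rat.HeightOneSpectrum.primesEquiv v₂ : ℕ) = 2 := primesEquiv_placeTwo
  -- good reduction of `Wd` at `v₂`; `v` lies over `v₂`
  have hgood : Wd.HasGoodReductionAt v₂ := hasGoodReductionAt_placeTwo Wd hord.1
  have hunder : v.asIdeal.under (𝓞 ℚ) = v₂.asIdeal := under_eq_placeTwo_of_two_mem K v hv
  haveI : v.asIdeal.LiesOver v₂.asIdeal := ⟨hunder.symm⟩
  refine ⟨hasGoodReductionAt_baseChange_of_hasGoodReductionAt Wd K v₂ v hgood, ?_⟩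
  -- the trace
  rw [Wd.frobeniusTraceAt_baseChange_eq_eval_dickson K hunder hgood, frobeniusTraceAt_eq_frobeniusTrace,
    hp2]
  have hq : (v₂.residueCard : ℤ) = 2 := by
    rw [← natCard_residueField_eq_residueCard, natCard_residueField_adicCompletionIntegers v₂, hp2]; rfl
  rw [hq]
  have hf : 0 < v.asIdeal.inertiaDeg (𝓞 ℚ) := Ideal.inertiaDeg_pos v.asIdeal (𝓞 ℚ)
  obtain ⟨n, hn⟩ : ∃ n, v.asIdeal.inertiaDeg (𝓞 ℚ) = n + 1 := ⟨_, (Nat.succ_pred_eq_of_pos hf).symm⟩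
  rw [hn]
  have hodd : Odd (Wd.frobeniusTrace 2) := by
    rcases Int.even_or_odd (Wd.frobeniusTrace 2) with h | h
    · exact absurd (even_iff_two_dvd.mp h) hord.2
    · exact h
  exact fun h2 ↦ (Int.not_even_iff_odd.mpr (odd_eval_dickson_succ hodd even_two n)) (even_iff_two_dvd.mpr h2)

/-! ## §C `hredK` -/

/-- `hredK` discharged: for `Wd/ℚ` globally minimal with good reduction at `2` and `K` a QUADRATIC field
with `2 ∣ d_K` (so `2` is ramified: ONE place `w ∣ 2`, `f(w|2) = 1`, `N(w) = 2`), the `2`-primary parts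
of `Ẽ_w(k_w)` and of `W̃(𝔽₂)` (reduction of the minimal model mod `2`) have the same order — indeed
`#Ẽ_w(k_w) = N(w) + 1 − a_w = 2 + 1 − a₂ = #W̃(𝔽₂)` (`a_w = D_1(a₂; 2) = a₂`). -/
theorem finprod_natCard_primaryComponent_reductionAt_two (Wd : WeierstrassCurve ℚ) [Wd.IsElliptic]
    [Wd.IsGloballyMinimal] (K : Type) [Field K] [NumberField K] (h2 : Module.finrank ℚ K = 2)
    (hdK : (2 : ℤ) ∣ NumberField.discr K) (hgoodP : Wd.HasGoodReductionAtPrime 2) :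
    (∏ᶠ v ∈ {v : HeightOneSpectrum (𝓞 K) | ((2 : ℕ) : 𝓞 K) ∈ v.asIdeal},
        Nat.card (AddCommGroup.primaryComponent ((Wd.baseChange K).reductionAt v).toAffine.Point 2) : ℕ) =
      Nat.card (AddCommGroup.primaryComponent
        ((integralModelInt Wd).map (Int.castRingHom (ZMod 2))).toAffine.Point 2) := by
  set v₂ : HeightOneSpectrum (𝓞 ℚ) := (Rat.HeightOneSpectrum.primesEquiv (R := 𝓞 ℚ)).symm ⟨2, Nat.prime_two⟩
    with hv₂
  have hp2 : (Rat.HeightOneSpectrum.primesEquiv v₂ : ℕ) = 2 := primesEquiv_placeTwo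
  have hgood : Wd.HasGoodReductionAt v₂ := hasGoodReductionAt_placeTwo Wd hgoodP
  obtain ⟨w, hw, huniq, hf1⟩ := WeierstrassCurve.exists_unique_place_of_dvd_discr K h2 v₂
    (by rw [hp2]; exact_mod_cast hdK)
  have h2w : ((2 : ℕ) : 𝓞 K) ∈ w.asIdeal := by
    have h := two_mem_placeTwo
    rw [← hw, Ideal.under_def, Ideal.mem_comap, map_natCast] at h
    exact h
  -- the set of places above `2` is `{w}`
  have hset : {v : HeightOneSpectrum (𝓞 K) | ((2 : ℕ) : 𝓞 K) ∈ v.asIdeal} = {w} := by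
    ext v
    simp only [Set.mem_setOf_eq, Set.mem_singleton_iff]
    refine ⟨fun hv ↦ huniq v (under_eq_placeTwo_of_two_mem K v (by exact_mod_cast hv)), ?_⟩
    rintro rfl
    exact h2w
  rw [hset, finprod_mem_singleton]
  -- point counts: `#Ẽ_w(k_w) = 2 + 1 - a₂ = #W̃(𝔽₂)`
  haveI : Fact (Nat.Prime 2) := ⟨Nat.prime_two⟩
  have hq : Nat.card (IsLocalRing.ResidueField (w.adicCompletionIntegers K)) = 2 := by
    rw [natCard_residueField_eq_residueCard]
    exact Summit.BirchSwinnertonDyer.Rank1Residual.Additive.absNorm_eq_of_quadratic_of_dvd_discr 2 K w h2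
      hdK (by exact_mod_cast h2w)
  have htr := Wd.frobeniusTraceAt_baseChange_eq_eval_dickson K hw hgood
  rw [hf1, Polynomial.dickson_one, Polynomial.eval_X, frobeniusTraceAt_eq_frobeniusTrace, hp2,
    frobeniusTraceAt_def, hq] at htr
  -- `htr : 2 + 1 - #Ẽ_w = frobeniusTrace Wd 2 = 2 + 1 - reductionPointCount Wd 2`
  have hcount : Nat.card ((Wd.baseChange K).reductionAt w).toAffine.Point =
      Nat.card ((integralModelInt Wd).map (Int.castRingHom (ZMod 2))).toAffine.Point := by
    have h : (Nat.card ((Wd.baseChange K).reductionAt w).toAffine.Point : ℤ) =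
        (reductionPointCount Wd 2 : ℤ) := by
      unfold frobeniusTrace at htr
      push_cast at htr
      linarith
    rw [reductionPointCount] at h
    exact_mod_cast h
  haveI : Finite ((Wd.baseChange K).reductionAt w).toAffine.Point := finite_point_of_finite _
  rw [natCard_primaryComponent_eq_pow_padicValNat 2, natCard_primaryComponent_eq_pow_padicValNat 2, hcount]


/-! ## §D `hdatK` -/

/-- In a quadratic field of discriminant `−4` there is `i` with `i² = −1`, `i ∉ ℚ` (`K = ℚ(√−4) = ℚ(i)`). -/
theorem exists_sq_eq_neg_one_of_discr_eq_neg_four (K : Type) [Field K] [NumberField K]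
    (h2 : Module.finrank ℚ K = 2) (hdK : NumberField.discr K = -4) :
    ∃ i : K, i ∉ Set.range (algebraMap ℚ K) ∧ i ^ 2 = -1 := by
  obtain ⟨θ, hθ, hθ2⟩ := exists_sq_eq_discr_not_mem_range K h2
  refine ⟨algebraMap ℚ K (1 / 2) * θ, ?_, ?_⟩
  · rintro ⟨q, hq⟩
    apply hθ
    refine ⟨2 * q, ?_⟩
    rw [map_mul, hq, ← mul_assoc, ← map_mul]
    norm_num
  · rw [mul_pow, hθ2, hdK, ← map_pow, ← map_mul]
    norm_num

/-- `hdatK` discharged: **a quadratic field `K` of discriminant `−4` has a cyclotomic `ℤ₂`-extension datum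
normalised by `χ_cyc(γ) = 5`.** Take `σ₀ ∈ Γ_ℚ` with `χ₂(σ₀) = 5` (`cyclotomicCharacter_rat_surjective`);
since `5 ≡ 1 (mod 4)`, `σ₀` fixes `i` hence the copy of `K = ℚ(i)` in `ℚ̄`, so `σ₀ = res γ₀` with
`γ₀ ∈ Γ_K` (`mem_range_absGaloisRestrict_iff_smul_absEmbedding`) and `χ₂^K(γ₀) = 5`
(`cyclotomicCharacter_eq_cyclotomicCharacter_rat_absGaloisRestrict`); the character `κ = ℓ ∘ χ₂^K`
(`ℓ = log/log 5`, tree `CyclotomicZp.ellHom`) has `κ(γ₀) = ℓ(5) = 1`, is onto `ℤ₂` (saturation,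
`exists_surjective_of_ne_one`, the exponent being `0` as `κ(γ₀) = 1`), and is cyclotomic (`ker ℓ = μ(ℤ₂)`).
[cite: Washington1997, §13.1] -/
theorem exists_isCyclotomic_isCycVariableOver_of_discr_eq_neg_four (K : Type) [Field K] [NumberField K]
    (h2 : Module.finrank ℚ K = 2) (hdK : NumberField.discr K = -4) :
    haveI : Fact (Nat.Prime 2) := ⟨Nat.prime_two⟩
    ∃ (κ : ZpExtension K 2) (γ : Field.absoluteGaloisGroup K), κ.IsCyclotomic ∧ κ.IsTopGenerator γ ∧
      IsCycVariableOver K ((cyclotomicGenerator 2 : ℕ) : ℤ_[2]) γ := by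
  haveI : Fact (Nat.Prime 2) := ⟨Nat.prime_two⟩
  haveI : NeZero ((2 : ℕ) : ℚ) := ⟨by norm_num⟩
  -- `i ∈ K`, and its image `z ∈ ℚ̄`
  obtain ⟨i, hi, hi2⟩ := exists_sq_eq_neg_one_of_discr_eq_neg_four K h2 hdK
  set e := Literature.NumberTheory.GaloisRepresentations.absEmbedding ℚ K with he
  set z : AlgebraicClosure ℚ := e i with hz
  have hz4 : z ^ 2 ^ 2 = 1 := by
    rw [show (2 : ℕ) ^ 2 = 2 * 2 from rfl, pow_mul, hz, ← map_pow, hi2]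
    simp
  -- `σ₀ ∈ Γ_ℚ` with `χ₂(σ₀) = 5`
  set χQ := Literature.NumberTheory.GaloisRepresentations.GaloisRep.cyclotomicCharacter ℚ 2 with hχQ
  obtain ⟨σ₀, hσ₀⟩ := Literature.NumberTheory.GaloisRepresentations.GaloisRep.cyclotomicCharacter_rat_surjective 2
    (CyclotomicZp.cycPowUnit 2 1)
  have h5 : ((CyclotomicZp.cycPowUnit 2 1 : ℤ_[2]ˣ) : ℤ_[2]) = ((cyclotomicGenerator 2 : ℕ) : ℤ_[2]) := by
    rw [CyclotomicZp.val_cycPowUnit, CyclotomicZp.cycPow_one]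
  have hgen : (cyclotomicGenerator 2 : ℕ) = 5 := by
    simp [cyclotomicGenerator, cyclotomicExponent]
  -- `σ₀` fixes `z`
  have hfixz : σ₀ • z = z := by
    have h := Literature.NumberTheory.GaloisRepresentations.GaloisRep.cyclotomicCharacter_spec ℚ 2 (k := 2) σ₀ z hz4
    rw [hσ₀, h5, hgen, map_natCast] at h
    rw [h]
    have hval : ((5 : ℕ) : ZMod (2 ^ 2)).val = 1 := by decide
    rw [hval, pow_one]
  -- hence fixes `e(K)` pointwise
  have hfix : ∀ x : K, σ₀ • e x = e x := by
    intro x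
    obtain ⟨a, b, rfl⟩ := Literature.NumberTheory.QuadraticFields.Quadratic.exists_eq_add_mul h2 hi x
    rw [map_add, map_mul, smul_add, smul_mul', AlgHom.commutes, AlgHom.commutes,
      Field.absoluteGaloisGroup.smul_def, Field.absoluteGaloisGroup.smul_def, AlgEquiv.commutes,
      AlgEquiv.commutes]
    change _ + _ * σ₀ • z = _
    rw [hfixz]
  obtain ⟨γ₀, hγ₀⟩ : σ₀ ∈ (Literature.NumberTheory.GaloisRepresentations.absGaloisRestrict ℚ K).range :=
    (Literature.NumberTheory.GaloisRepresentations.mem_range_absGaloisRestrict_iff_smul_absEmbedding ℚ K σ₀).mpr hfix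
  -- `χ₂^K(γ₀) = 5`
  set χK := Literature.NumberTheory.GaloisRepresentations.GaloisRep.cyclotomicCharacter K 2 with hχK
  have hχγ : χK γ₀ = CyclotomicZp.cycPowUnit 2 1 := by
    rw [hχK, Literature.NumberTheory.GaloisRepresentations.cyclotomicCharacter_eq_cyclotomicCharacter_rat_absGaloisRestrict
      K 2 γ₀]
    have hγ₀' : Literature.NumberTheory.GaloisRepresentations.absGaloisRestrict ℚ K γ₀ = σ₀ := hγ₀
    change χQ (Literature.NumberTheory.GaloisRepresentations.absGaloisRestrict ℚ K γ₀) = _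
    rw [hγ₀', hχQ, hσ₀]
  -- `κ = ℓ ∘ χ₂^K`
  set f : Field.absoluteGaloisGroup K →ₜ* Multiplicative ℤ_[2] := (CyclotomicZp.ellHom 2).comp χK with hf
  have hfapply : ∀ σ, f σ = Multiplicative.ofAdd (CyclotomicZp.ell 2 (χK σ)) := fun σ ↦ rfl
  have hfγ : f γ₀ = Multiplicative.ofAdd 1 := by
    rw [hfapply, hχγ, CyclotomicZp.ell_cycPowUnit]
  have hf1 : f ≠ 1 := by
    intro h1
    have h : Multiplicative.ofAdd (1 : ℤ_[2]) = Multiplicative.ofAdd 0 := by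
      rw [← hfγ, h1, ofAdd_zero]; rfl
    exact one_ne_zero (Multiplicative.ofAdd.injective h)
  obtain ⟨g, k, hg, hgf⟩ := ZpExtension.exists_surjective_of_ne_one f hf1
  -- the saturation exponent is `0`: `1 = 2^k · g(γ₀)`
  have hk : k = 0 := by
    by_contra hk
    have h := hgf γ₀
    rw [hfγ, toAdd_ofAdd] at h
    have hu : IsUnit (((2 : ℕ) : ℤ_[2]) ^ k) := IsUnit.of_mul_eq_one _ h.symm
    rw [isUnit_pow_iff hk, PadicInt.isUnit_iff, PadicInt.norm_p] at hu
    norm_num at hu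
  have hfg : ∀ σ, f σ = g σ := fun σ ↦ by
    apply Multiplicative.toAdd.injective
    rw [hgf σ, hk, pow_zero, one_mul]
  have hfsurj : Function.Surjective f := fun y ↦ by
    obtain ⟨σ, hσ⟩ := hg y
    exact ⟨σ, by rw [hfg, hσ]⟩
  refine ⟨⟨f, hfsurj⟩, γ₀, ?_, ?_, ?_⟩
  · -- cyclotomic: `ker (ℓ ∘ χ) = χ⁻¹(μ(ℤ₂))`
    ext σ
    rw [ZpExtension.mem_kerSubgroup, Subgroup.mem_comap, CommGroup.mem_torsion]
    change f σ = 1 ↔ _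
    rw [hfapply, ofAdd_eq_one, CyclotomicZp.ell_eq_zero_iff]
    rfl
  · -- `κ γ₀ = 1`
    change f γ₀ = Multiplicative.ofAdd 1
    exact hfγ
  · -- `χ₂(γ₀) = 5`
    change ((χK γ₀ : ℤ_[2]ˣ) : ℤ_[2]) = _
    rw [hχγ, h5]

end AddDescentK

end Summit.BirchSwinnertonDyer.BirchSwinnertonDyer.Theorems

end
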